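import Summits.QuantumFields.YangMills.Theorems.SwapVirialDeficitSectorLaplaceTipCornerConcrete
import Summits.QuantumFields.YangMills.Theorems.SwapVirialDeficitSectorLaplaceMbDensityComparableProfile
import HarnessLib

/-!
# THE TIP OF SKELETON ➎, GLUE TRANSFER: moving the profile integral from the producers' letter `δs'` down to the reference shell `[δr(L), 2δr(L)]`
# (cell ym-idea-1; free-hands support of ⟨stmt-QuantumFields-24197⟩ `SwapVirialDeficit.SwapGluedStiffness`; input of the glue `stub_core_tip_of_core`)

* `coreProfile_transfer` — for `δs ∈ [δr(L), 2δr(L)]`, `2δr(L) ≤ δs'` and any `δt`: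
  `∫ Profile(δt,p)·𝔪(hubAt δs' 1) ε p ≤ R₀(L)·(1+δs'²)²·∫ Profile(δt,p)·𝔪(hubAt δs 1) ε p`, by ✓`mbDensity_hubAt_comparable_profile` with `p' = p`
  (window ✓`cornerWindow_facts`), the profile factor `≤ (1+δs'²)²`, and monotonicity of the integral (the shell density is integrable by hypothesis).

HONEST LABEL: bookkeeping; `stub_core_tip` (hCore multi-seat + glue), ⟨24197⟩ ∕ ⟨24194⟩ OPEN; item of record ⟨24085⟩ aside ∕ untouched; the Yang–Mills mass gap is NOT proved;
no summit is proved by a line.  THEOREMS ONLY (0 `def`, 0 `sorry`), standard axioms, no instances.  Seat ym-line-fcl-p3 g49, `--supports stmt-QuantumFields-24197`.  References: [folklore].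
-/


set_option autoImplicit false
set_option synthInstance.maxSize 1024

noncomputable section

open MeasureTheory Quaternion Set Module
open scoped Quaternion BigOperators ENNReal
open Literature.MathematicalPhysics.QuantumLattice
open Literature.MathematicalPhysics.QuantumFieldTheory hiding SU2
open Summit.QuantumFields.YangMills.Theorems.SwapTwistDeficit.ToronLog

namespace Summit.QuantumFields.YangMills.Theorems.SwapVirialDeficit.SectorLaplace

open Summit.QuantumFields.YangMills.Theorems.FemtoTransferGap
open Summit.QuantumFields.YangMills.Theorems.FemtoTransferGap.TT
open Summit.QuantumFields.YangMills.Theorems.VirialFluxGap.RingDeficit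
open Summit.QuantumFields.YangMills.Theorems.SwapVirialDeficit.SwapRing
open Summit.QuantumFields.YangMills.Theorems.SwapVirialDeficit.BlowUpRing

variable {L : ℕ} [NeZero L]

set_option maxHeartbeats 1600000 in
/-- ★ The shell transfer of the profile integral: for `δs ∈ [δr(L), 2δr(L)]`, `2δr(L) ≤ δs'` and any `δt`,
`∫ Profile(δt,p)·𝔪(hubAt δs' 1) ε p ≤ R₀(L)·(1+δs'²)²·∫ Profile(δt,p)·𝔪(hubAt δs 1) ε p` (✓`mbDensity_hubAt_comparable_profile` with `p' = p`). [folklore] -/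
theorem coreProfile_transfer {ε : GnoSign L} (hε : GoodSign ε) {δs δs' : ℝ}
    (hδs : δs ∈ Icc (12 * 122689728 * 2304 * (Fintype.card (Fol L) : ℝ) ^ 2 * (L : ℝ) ^ 10) (2 * (12 * 122689728 * 2304 * (Fintype.card (Fol L) : ℝ) ^ 2 * (L : ℝ) ^ 10)))
    (hδs' : 2 * (12 * 122689728 * 2304 * (Fintype.card (Fol L) : ℝ) ^ 2 * (L : ℝ) ^ 10) ≤ δs')
    (hInt : Integrable fun p : ℝ × ℝ => mbDensity (L := L) (hubAt δs 1) ε p) (δt : ℝ) :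
    ∫ p : ℝ × ℝ, ((1 + δt ^ 2) ^ 2 / (1 + (p.1 ^ 2 / (1 + p.1 ^ 2) + p.2 ^ 2 / (1 + p.2 ^ 2)) * (1 + δt ^ 2))) * mbDensity (L := L) (hubAt δs' 1) ε p ≤
      (Real.exp 1 * ((1 + (finrank ℝ (GnoFol L) : ℝ)) * (20400 * (L : ℝ) ^ 4)) ^ (7 / 2 : ℝ) *
          (Real.sqrt ((1 / 4 : ℝ) * (1 / (1800 * (L : ℝ) ^ 6))) ^ 3)⁻¹ * (2 * (1800 * (L : ℝ) ^ 6) ^ 2)) * (1 + δs' ^ 2) ^ 2 *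
        ∫ p : ℝ × ℝ, ((1 + δt ^ 2) ^ 2 / (1 + (p.1 ^ 2 / (1 + p.1 ^ 2) + p.2 ^ 2 / (1 + p.2 ^ 2)) * (1 + δt ^ 2))) * mbDensity (L := L) (hubAt δs 1) ε p := by
  obtain ⟨hδr1, -, -, hwin1, -⟩ := cornerWindow_facts (L := L)
  set n : ℝ := (Fintype.card (Fol L) : ℝ) with hn
  set δr : ℝ := 12 * 122689728 * 2304 * n ^ 2 * (L : ℝ) ^ 10 with hδr
  set R₀ : ℝ := Real.exp 1 * ((1 + (finrank ℝ (GnoFol L) : ℝ)) * (20400 * (L : ℝ) ^ 4)) ^ (7 / 2 : ℝ) *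
      (Real.sqrt ((1 / 4 : ℝ) * (1 / (1800 * (L : ℝ) ^ 6))) ^ 3)⁻¹ * (2 * (1800 * (L : ℝ) ^ 6) ^ 2) with hR₀
  set prof : ℝ × ℝ → ℝ := fun p => (1 + δt ^ 2) ^ 2 / (1 + (p.1 ^ 2 / (1 + p.1 ^ 2) + p.2 ^ 2 / (1 + p.2 ^ 2)) * (1 + δt ^ 2)) with hprof
  have hL1 : (1 : ℝ) ≤ L := by exact_mod_cast NeZero.one_le
  have hR₀0 : 0 ≤ R₀ := by
    rw [hR₀]
    have h1 : 0 < Real.sqrt ((1 / 4 : ℝ) * (1 / (1800 * (L : ℝ) ^ 6))) := Real.sqrt_pos.2 (by positivity)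
    positivity
  have hrt : δr ≤ δs' := by linarith only [hδr1, hδs']
  have hS0 : 0 < 1 + δs' ^ 2 := by positivity
  have hprof0 : ∀ p, 0 ≤ prof p := fun p => by rw [hprof]; positivity
  have hprofT : ∀ p, prof p ≤ (1 + δt ^ 2) ^ 2 := fun p => by
    rw [hprof]
    exact div_le_self (by positivity) (le_add_of_nonneg_right (mul_nonneg (by positivity) (by positivity)))
  -- pointwise comparability with `p' = p`
  have hpt : ∀ p : ℝ × ℝ, mbDensity (L := L) (hubAt δs' 1) ε p ≤ R₀ * (1 + δs' ^ 2) ^ 2 * mbDensity (L := L) (hubAt δs 1) ε p := by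
    intro p
    have hw : (122689728 * δr⁻¹ + 44712000 * ‖(gnoBase p.1 p.2 : GnoCoord L) - gnoBase p.1 p.2‖) * (L : ℝ) ^ 4 ≤
        (2304 * (L : ℝ) ^ 6 * (Fintype.card (Fol L) : ℝ))⁻¹ / (2 * (3 * (Fintype.card (Fol L) : ℝ))) := by
      rw [sub_self, norm_zero, mul_zero, add_zero, hwin1]
      exact half_le_self (by positivity)
    have h := mbDensity_hubAt_comparable_profile (L := L) hε hδr1 hδs.1 hrt p p hw
    have hms0 : 0 ≤ mbDensity (L := L) (hubAt δs 1) ε p := mbDensity_nonneg _ ε p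
    have hfrac : (1 + δs' ^ 2) ^ 2 / (1 + (p.1 ^ 2 / (1 + p.1 ^ 2) + p.2 ^ 2 / (1 + p.2 ^ 2)) * (1 + δs' ^ 2)) ≤ (1 + δs' ^ 2) ^ 2 :=
      div_le_self (by positivity) (le_add_of_nonneg_right (mul_nonneg (by positivity) hS0.le))
    have hwt : (1 + p.1 ^ 2) * (1 + p.2 ^ 2) / ((1 + p.1 ^ 2) * (1 + p.2 ^ 2)) = 1 := div_self (by positivity)
    rw [hwt, mul_one] at h
    calc mbDensity (L := L) (hubAt δs' 1) ε p
        ≤ R₀ * ((1 + δs' ^ 2) ^ 2 / (1 + (p.1 ^ 2 / (1 + p.1 ^ 2) + p.2 ^ 2 / (1 + p.2 ^ 2)) * (1 + δs' ^ 2))) * mbDensity (L := L) (hubAt δs 1) ε p := h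
      _ ≤ R₀ * (1 + δs' ^ 2) ^ 2 * mbDensity (L := L) (hubAt δs 1) ε p :=
          mul_le_mul_of_nonneg_right (mul_le_mul_of_nonneg_left hfrac hR₀0) hms0
  -- integrability of `prof·𝔪(δs)`
  have hfm : AEStronglyMeasurable (fun p : ℝ × ℝ => prof p * mbDensity (L := L) (hubAt δs 1) ε p) volume := by
    have h1 : Measurable prof := by rw [hprof]; fun_prop
    exact (h1.aestronglyMeasurable).mul hInt.aestronglyMeasurable
  have hfi : Integrable (fun p : ℝ × ℝ => prof p * mbDensity (L := L) (hubAt δs 1) ε p) := by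
    refine Integrable.mono' (hInt.const_mul ((1 + δt ^ 2) ^ 2)) hfm (Filter.Eventually.of_forall fun p => ?_)
    rw [Real.norm_eq_abs, abs_of_nonneg (mul_nonneg (hprof0 p) (mbDensity_nonneg _ ε p))]
    exact mul_le_mul_of_nonneg_right (hprofT p) (mbDensity_nonneg _ ε p)
  calc ∫ p : ℝ × ℝ, prof p * mbDensity (L := L) (hubAt δs' 1) ε p
      ≤ ∫ p : ℝ × ℝ, (R₀ * (1 + δs' ^ 2) ^ 2) * (prof p * mbDensity (L := L) (hubAt δs 1) ε p) := by
        refine integral_mono_of_nonneg (Filter.Eventually.of_forall fun p => mul_nonneg (hprof0 p) (mbDensity_nonneg _ ε p))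
          (hfi.const_mul _) (Filter.Eventually.of_forall fun p => ?_)
        calc prof p * mbDensity (L := L) (hubAt δs' 1) ε p ≤ prof p * (R₀ * (1 + δs' ^ 2) ^ 2 * mbDensity (L := L) (hubAt δs 1) ε p) :=
              mul_le_mul_of_nonneg_left (hpt p) (hprof0 p)
          _ = (R₀ * (1 + δs' ^ 2) ^ 2) * (prof p * mbDensity (L := L) (hubAt δs 1) ε p) := by ring
    _ = R₀ * (1 + δs' ^ 2) ^ 2 * ∫ p : ℝ × ℝ, prof p * mbDensity (L := L) (hubAt δs 1) ε p := integral_const_mul _ _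

end Summit.QuantumFields.YangMills.Theorems.SwapVirialDeficit.SectorLaplace

end
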